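import Literature.NumberTheory.Transcendental.KZProductIdeal
import Literature.NumberTheory.Transcendental.KZRulesAssociator
import Literature.NumberTheory.Transcendental.KZCalculusProofs
import Literature.NumberTheory.Transcendental.SemialgebraicMapsProofs

/-!
# `LogKernelConjecture` (stmt-KontsevichZagierPeriods-2837) — line `spectator-localisation`,
stub `stub_intervalUnit` (E3, the interval unit)

The normalised interval `u = [[a, b] ⊆ ℝ¹, (b - a)⁻¹]` (`a < b` rational) is a **unit of the formal
period ring modulo the Kontsevich–Zagier relations**: `[u] * c - c ∈ KZ.relations` for every formal
combination `c`. Proof: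
(1) the defect `c ↦ [u] * c - c` is additive, so it suffices to treat generators `c = [r]`
(`KZ.map_mem_relations_of_forall_of`);
(2) the product is commutative modulo relations (`KZ.of_mul_of_sub_of_mul_of_mem_relations`), so
it suffices to show `[r] * [u] - [r] = [r.prod u] - [r] ∈ KZ.relations` (`KZ.of_mul_of`);
(3) `[r.prod u] - [r]` is ONE Newton–Leibniz move (printed rule (3)) over the base `r`, with the
constant edges `a ≤ b`, the band `σ × [a, b] = (r.prod u).domain` and the primitive
`F (x, t) = (t - a) (b - a)⁻¹ f x`: `∂F/∂t = f x · (b - a)⁻¹ = (f ⊗ (b - a)⁻¹) (x, t)` is the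
integrand of the product (`KZ.IntegralRep.prod_integrand_eq`) and `F (x, b) - F (x, a) = f x`
(exactly as for the unit slab, `KZ.IntegralRep.of_slab_sub_of_mem_newtonLeibnizRel`).
[folklore]
-/

noncomputable section

open MeasureTheory Set
open Literature.NumberTheory.Transcendental

namespace Summit.KontsevichZagierPeriods.LiouvilleUnfolding.SpectatorLocalisation

/-! ## One Newton–Leibniz move -/

/-- **`[r.prod u] - [r]` is a single Newton–Leibniz move** when `u = [[a, b], (b - a)⁻¹]` is the
normalised rational interval (`a < b`): base `r = (σ, f)`, constant edges `a ≤ b`, band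
`(r.prod u).domain = {(x, t) | x ∈ σ, a ≤ t ≤ b}` (`KZ.IntegralRep.mem_prodDomain`), primitive
`F (x, t) = (t - a) (b - a)⁻¹ f x` (a polynomial in `t` times `f ∘ init`, semialgebraic on the band
by `IsSemialgebraicFunOn.mul_holds` and `IsSemialgebraicFunOn.comp_init`), whose `t`-derivative is
the integrand `f x · (b - a)⁻¹` of the product (`KZ.IntegralRep.prod_integrand_eq`,
`KZ.IntegralRep.prodFun_apply`) and whose boundary term is `F (x, b) - F (x, a) = f x`.
[cite: KontsevichZagier2001, §1.2] -/
theorem stub_intervalUnit_of_prod_sub_of_mem_newtonLeibnizRel {a b : ℚ} (hab : a < b)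
    {u : KZ.IntegralRep 1} (hu : u.domain = {t : Fin 1 → ℝ | (a : ℝ) ≤ t 0 ∧ t 0 ≤ (b : ℝ)})
    (hui : u.integrand = fun _ => ((b - a : ℚ) : ℝ)⁻¹) {n : ℕ} (r : KZ.IntegralRep n) :
    KZ.of (r.prod u) - KZ.of r ∈ KZ.newtonLeibnizRel := by
  -- casts of the normalising constant
  have hba : ((b - a : ℚ) : ℝ) = (b : ℝ) - a := Rat.cast_sub b a
  have hab' : (a : ℝ) ≤ b := by exact_mod_cast hab.le
  have hba0 : (b : ℝ) - a ≠ 0 := sub_ne_zero.mpr (ne_of_gt (by exact_mod_cast hab))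
  -- the last coordinate of `ℝⁿ⁺¹ = ℝⁿ × ℝ¹`
  have h0 : ∀ z : Fin (n + 1) → ℝ, z (Fin.natAdd n (0 : Fin 1)) = z (Fin.last n) :=
    fun z => congrArg z (Fin.ext rfl)
  -- the band is semialgebraic
  have hband : Literature.ModelTheory.ExponentialFields.IsSemialgebraic ℚ (r.prod u).domain :=
    (r.prod u).isSemialgebraic_domain
  -- the integrand of the product is `f x · (b - a)⁻¹`
  have hint : ∀ z : Fin (n + 1) → ℝ,
      (r.prod u).integrand z = r.integrand (Fin.init z) * ((b - a : ℚ) : ℝ)⁻¹ := by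
    intro z
    rw [KZ.IntegralRep.prod_integrand_eq, KZ.IntegralRep.prodFun_apply, hui]
    rfl
  refine ⟨n, r.prod u, r, fun _ => (a : ℝ), fun _ => (b : ℝ),
    fun z => (z (Fin.last n) - a) * ((b - a : ℚ) : ℝ)⁻¹ * r.integrand (Fin.init z),
    ?_, ?_, ?_, fun _ _ => hab', ?_, ?_, ?_, ?_, rfl⟩
  · -- `F = (X_last - a) (b - a)⁻¹ · (f ∘ init)` is a product of semialgebraic functions on the band
    refine IsSemialgebraicFunOn.mul_holds ?_ ?_
    · exact (isSemialgebraicFunOn_aeval hband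
        ((MvPolynomial.X (Fin.last n) - MvPolynomial.C a) * MvPolynomial.C (b - a)⁻¹)).congr
        fun z _ => by simp
    · exact r.isSemialgebraicFunOn_integrand.comp_init.mono (fun z hz => hz.1) hband
  · -- the lower edge `a` is semialgebraic
    exact (isSemialgebraicFunOn_aeval r.isSemialgebraic_domain (MvPolynomial.C a)).congr
      fun x _ => by simp
  · -- the upper edge `b` is semialgebraic
    exact (isSemialgebraicFunOn_aeval r.isSemialgebraic_domain (MvPolynomial.C b)).congr
      fun x _ => by simp
  · -- the band equation `σ × [a, b] = {z | init z ∈ σ ∧ a ≤ z last ≤ b}`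
    ext z
    simp only [KZ.IntegralRep.prod_domain, KZ.IntegralRep.mem_prodDomain, hu, mem_setOf_eq, h0]
    exact Iff.rfl
  · -- continuity of `t ↦ F (x, t)` on the closed fibre
    intro x _
    simp only [Fin.snoc_last, Fin.init_snoc]
    fun_prop
  · -- `∂/∂t F (x, t) = f x · (b - a)⁻¹` on the open fibre
    intro x _ t _
    rw [hint]
    simp only [Fin.snoc_last, Fin.init_snoc]
    have hd : HasDerivAt (fun s : ℝ => (s - a) * ((b - a : ℚ) : ℝ)⁻¹ * r.integrand x)
        ((1 : ℝ) * ((b - a : ℚ) : ℝ)⁻¹ * r.integrand x) t :=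
      (((hasDerivAt_id' t).sub_const _).mul_const _).mul_const _
    convert hd using 1
    ring
  · -- the boundary term is the original integrand
    intro x _
    simp only [Fin.snoc_last, Fin.init_snoc, hba]
    rw [sub_self, zero_mul, zero_mul, sub_zero, mul_inv_cancel₀ hba0, one_mul]

/-- For the normalised rational interval `u = [[a, b], (b - a)⁻¹]` and every representation `r`,
`[r] * [u] - [r] ∈ KZ.relations`: `[r] * [u] = [r.prod u]` (`KZ.of_mul_of`) and
`[r.prod u] - [r]` is a Newton–Leibniz move
(`stub_intervalUnit_of_prod_sub_of_mem_newtonLeibnizRel`, `KZ.newtonLeibnizRel_subset_relations`).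
[cite: KontsevichZagier2001, §1.2] -/
theorem stub_intervalUnit_of_mul_of_sub_of_mem_relations {a b : ℚ} (hab : a < b)
    {u : KZ.IntegralRep 1} (hu : u.domain = {t : Fin 1 → ℝ | (a : ℝ) ≤ t 0 ∧ t 0 ≤ (b : ℝ)})
    (hui : u.integrand = fun _ => ((b - a : ℚ) : ℝ)⁻¹) {n : ℕ} (r : KZ.IntegralRep n) :
    KZ.of r * KZ.of u - KZ.of r ∈ KZ.relations := by
  rw [KZ.of_mul_of]
  exact KZ.newtonLeibnizRel_subset_relations
    (stub_intervalUnit_of_prod_sub_of_mem_newtonLeibnizRel hab hu hui r)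

/-! ## The stub -/

/-- **Stub E3 — the interval unit.** The normalised rational interval `u = [[a, b] ⊆ ℝ¹, (b - a)⁻¹]`
(`a < b`) is a unit of the formal period ring modulo relations: `[u] * c - c ∈ KZ.relations` for
every `c : KZ.FormalRep`. The defect `c ↦ [u] * c - c` is the additive endomorphism
`mulLeft [u] - id`, so it suffices to treat generators `[r]` (`KZ.map_mem_relations_of_forall_of`);
there `[u] * [r] - [r] = ([u] * [r] - [r] * [u]) + ([r] * [u] - [r])`, the first bracket a relation
by commutativity modulo relations (`KZ.of_mul_of_sub_of_mul_of_mem_relations`), the second a single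
Newton–Leibniz move (`stub_intervalUnit_of_mul_of_sub_of_mem_relations`).
[cite: KontsevichZagier2001, §1.2] -/
theorem stub_intervalUnit : ∀ (a b : ℚ) (u : Literature.NumberTheory.Transcendental.KZ.IntegralRep 1), a < b → u.domain = {t : Fin 1 → ℝ | (a : ℝ) ≤ t 0 ∧ t 0 ≤ (b : ℝ)} → (u.integrand = fun _ => ((b - a : ℚ) : ℝ)⁻¹) → ∀ c : Literature.NumberTheory.Transcendental.KZ.FormalRep, Literature.NumberTheory.Transcendental.KZ.of u * c - c ∈ Literature.NumberTheory.Transcendental.KZ.relations := by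
  intro a b u hab hu hui c
  refine KZ.map_mem_relations_of_forall_of
    (AddMonoidHom.mulLeft (KZ.of u) - AddMonoidHom.id KZ.FormalRep) (fun n r => ?_) c
  change KZ.of u * KZ.of r - KZ.of r ∈ KZ.relations
  have h := KZ.relations.add_mem (KZ.of_mul_of_sub_of_mul_of_mem_relations u r)
    (stub_intervalUnit_of_mul_of_sub_of_mem_relations hab hu hui r)
  rwa [sub_add_sub_cancel] at h

end Summit.KontsevichZagierPeriods.LiouvilleUnfolding.SpectatorLocalisation

end
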